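/-
Copyright (c) 2026. All rights reserved.
Released under Apache 2.0 license as described in the file LICENSE.
Authors: abc-iut cell, seat abc-iut-w5-d200 (gen 5).
-/
import Literature.AnabelianGeometry.AbsoluteAnabelian.MLFGaloisTameStronglyComplete
import Literature.GroupTheory.ProPPowerMap

/-!
# `Γ_F` is strongly complete away from `p`

Let `F` be a non-archimedean local field with residue characteristic `p`, `Γ_F = Gal(F̄/F)` and
`P_F = absWildInertia F ϖ` its wild inertia group (`ϖ` a uniformiser).  By
`MLFGaloisTameStronglyComplete.isOpen_of_finiteIndex_of_absWildInertia_le` every finite-index subgroup of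
`Γ_F` containing `P_F` is open (for `Γ_F` topologically finitely generated).  Since `P_F` is pro-`p`
(`absWildInertia_isProP_holds`, PROVED in the tree), `P_F` is `m`-divisible for every `m` prime to `p`
(`Literature.GroupTheory.pow_surjective_of_proP`), hence contained in every normal subgroup of index
prime to `p`.  Consequences (proof-only file, 0 definitions):

* `isPGroup_absWildInertia_quotient` — `P_F` is pro-`p` in the quotient phrasing (finite quotients by
  open normal subgroups of `P_F` are `p`-groups);
* `exists_mem_absWildInertia_pow_eq` — the `m`-power map of `P_F` is surjective for `p ∤ m`;
* `absWildInertia_le_of_index_coprime` — `P_F ≤ N` for every normal subgroup `N` of finite index prime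
  to `p` (openness of `N` NOT assumed);
* `isOpen_of_normal_of_index_coprime` — **every normal subgroup of `Γ_F` of finite index prime to `p`
  is open**;
* `continuous_of_card_coprime` — **every homomorphism from `Γ_F` to a finite (discrete) group of order
  prime to `p` is continuous**.

So the strong completeness of `Γ_F` («every finite-index subgroup is open», the instance of the
Nikolov–Segal fact F-1977 consumed by the abc-iut cone, GAP row G-L3d2g2-1) is reduced to finite
quotients whose order is divisible by `p` — precisely the wild main lemma of the reduction recorded on
the cell's STATUS board (seat w5-d006).  Nothing here asserts anything about [IUTchIII] Cor. 3.12.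

[cite: SerreLocalFields1979, Ch. IV §2 Cor. 1 and Cor. 3 of Prop. 7] [cite: DDMSAnalyticProP1999, §1.2]
[cite: RibesZalesskii2010, §4.2]
-/

noncomputable section

open Field ValuativeRel
open scoped Pointwise Valued

namespace Literature.AnabelianGeometry.AbsoluteAnabelian

namespace MLFGaloisTameStronglyComplete

open Literature.NumberTheory.GaloisRepresentations
open Literature.NumberTheory.GaloisRepresentations.IsNonarchimedeanLocalField
open Literature.GroupTheory
open _root_.Topology

universe u

variable {F : Type u} [Field F] [ValuativeRel F] [TopologicalSpace F] [IsNonarchimedeanLocalField F]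

/-- **`P_F` is pro-`p`** (quotient phrasing, for the subspace topology of `P_F = absWildInertia F ϖ`):
every quotient of `P_F` by an open normal subgroup of `P_F` is a `p`-group, `p = ringChar 𝓀[F]`.  From
the tree's neighbourhood phrasing `absWildInertia_isProP_holds` (`σ ^ p ^ a → 1`).
[cite: SerreLocalFields1979, Ch. IV §2 Cor. 3 of Prop. 7] -/
theorem isPGroup_absWildInertia_quotient {ϖ : 𝒪[F]} (hϖ : Irreducible ϖ)
    (U : OpenNormalSubgroup ↥(absWildInertia F ϖ)) :
    IsPGroup (ringChar 𝓀[F]) (↥(absWildInertia F ϖ) ⧸ (U : Subgroup ↥(absWildInertia F ϖ))) := by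
  haveI : CompactSpace (absoluteGaloisGroup F) := absoluteGaloisGroup_compactSpace F
  refine isPGroup_quotient_openNormalSubgroup_of_forall_nhds (fun g W hW => ?_) U
  -- a neighbourhood of `1` in `P_F` contains the trace of an open normal subgroup of `Γ_F`
  obtain ⟨O, hOW, hO, h1O⟩ := mem_nhds_iff.mp hW
  obtain ⟨O', hO', hOO'⟩ := isOpen_induced_iff.mp hO
  have h1O' : (1 : absoluteGaloisGroup F) ∈ O' := by
    have : (1 : ↥(absWildInertia F ϖ)) ∈ Subtype.val ⁻¹' O' := by rw [hOO']; exact h1O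
    exact this
  obtain ⟨N, hN⟩ := ProfiniteGrp.exist_openNormalSubgroup_sub_open_nhds_of_one hO' h1O'
  obtain ⟨a, ha⟩ := absWildInertia_isProP_holds F hϖ g.2 (N : Subgroup (absoluteGaloisGroup F))
    N.isOpen'
  refine ⟨a, hOW ?_⟩
  have : (g ^ ringChar 𝓀[F] ^ a : ↥(absWildInertia F ϖ)) ∈ Subtype.val ⁻¹' O' := by
    show ((g ^ ringChar 𝓀[F] ^ a : ↥(absWildInertia F ϖ)) : absoluteGaloisGroup F) ∈ O'
    rw [Subgroup.coe_pow]
    exact hN ha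
  rwa [hOO'] at this

/-- **The `m`-power map of `P_F` is surjective for `p ∤ m`**: every `π ∈ P_F` is an `m`-th power of an
element of `P_F` (pro-`p` groups are uniquely `m`-divisible, `pow_surjective_of_proP`).
[cite: DDMSAnalyticProP1999, §1.2] -/
theorem exists_mem_absWildInertia_pow_eq {ϖ : 𝒪[F]} (hϖ : Irreducible ϖ) {m : ℕ}
    (hm : (ringChar 𝓀[F]).Coprime m) {π : absoluteGaloisGroup F} (hπ : π ∈ absWildInertia F ϖ) :
    ∃ ρ ∈ absWildInertia F ϖ, ρ ^ m = π := by
  haveI : CompactSpace (absoluteGaloisGroup F) := absoluteGaloisGroup_compactSpace F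
  haveI : CompactSpace ↥(absWildInertia F ϖ) :=
    ProfiniteSubquotients.compactSpace_of_isClosed (isClosed_absWildInertia F ϖ)
  obtain ⟨ρ, hρ⟩ := pow_surjective_of_proP (G := ↥(absWildInertia F ϖ))
    (isPGroup_absWildInertia_quotient hϖ) hm ⟨π, hπ⟩
  refine ⟨ρ, ρ.2, ?_⟩
  have := congrArg Subtype.val hρ
  simpa using this

/-- **`P_F` lies in every normal subgroup of `Γ_F` of finite index prime to `p`** (openness NOT
assumed): `π = ρ ^ [Γ_F : N]` with `ρ ∈ P_F`, and `ρ ^ [Γ_F : N] ∈ N`.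
[cite: SerreLocalFields1979, Ch. IV §2 Cor. 3 of Prop. 7] -/
theorem absWildInertia_le_of_index_coprime {ϖ : 𝒪[F]} (hϖ : Irreducible ϖ)
    (N : Subgroup (absoluteGaloisGroup F)) [N.Normal] [N.FiniteIndex]
    (hN : (ringChar 𝓀[F]).Coprime N.index) : absWildInertia F ϖ ≤ N := by
  intro π hπ
  obtain ⟨ρ, -, rfl⟩ := exists_mem_absWildInertia_pow_eq hϖ hN hπ
  exact N.pow_index_mem ρ

variable (F) in
/-- **Every normal subgroup of `Γ_F` of finite index prime to `p` is open** (`Γ_F` topologically finitely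
generated — unconditional for `F` of characteristic `0`, `Summits/ABC/IUTFork/MLFGaloisTFG.lean` —, `ϖ` a
uniformiser): it contains `P_F` (`absWildInertia_le_of_index_coprime`) and the tame quotient is strongly
complete (`isOpen_of_finiteIndex_of_absWildInertia_le`).
[cite: SerreLocalFields1979, Ch. IV §2 Cor. 1 and Cor. 3 of Prop. 7] [cite: RibesZalesskii2010, §4.2] -/
theorem isOpen_of_normal_of_index_coprime
    (hG : IsTopologicallyFinitelyGenerated (absoluteGaloisGroup F)) {ϖ : 𝒪[F]} (hϖ : Irreducible ϖ)
    (N : Subgroup (absoluteGaloisGroup F)) [N.Normal] [N.FiniteIndex]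
    (hN : (ringChar 𝓀[F]).Coprime N.index) : IsOpen (N : Set (absoluteGaloisGroup F)) :=
  isOpen_of_finiteIndex_of_absWildInertia_le F hG hϖ N (absWildInertia_le_of_index_coprime hϖ N hN)

variable (F) in
/-- The uniformiser-free form: for `Γ_F` topologically finitely generated, every normal subgroup of
finite index prime to `p` is open (a uniformiser exists: `𝒪[F]` is a discrete valuation ring).
[cite: SerreLocalFields1979, Ch. IV §2 Cor. 1 and Cor. 3 of Prop. 7] -/
theorem isOpen_of_normal_of_index_coprime'
    (hG : IsTopologicallyFinitelyGenerated (absoluteGaloisGroup F))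
    (N : Subgroup (absoluteGaloisGroup F)) [N.Normal] [N.FiniteIndex]
    (hN : (ringChar 𝓀[F]).Coprime N.index) : IsOpen (N : Set (absoluteGaloisGroup F)) := by
  obtain ⟨ϖ, hϖ⟩ := IsDiscreteValuationRing.exists_irreducible 𝒪[F]
  exact isOpen_of_normal_of_index_coprime F hG hϖ N hN

variable (F) in
/-- **Every homomorphism from `Γ_F` to a finite discrete group of order prime to `p` is continuous**
(`Γ_F` topologically finitely generated): its kernel is a normal subgroup of index dividing the order of
the target, hence open. [cite: SerreLocalFields1979, Ch. IV §2] [cite: RibesZalesskii2010, §4.2] -/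
theorem continuous_of_card_coprime
    (hG : IsTopologicallyFinitelyGenerated (absoluteGaloisGroup F))
    {H : Type*} [Group H] [Finite H] [TopologicalSpace H] [DiscreteTopology H]
    (f : absoluteGaloisGroup F →* H) (hH : (ringChar 𝓀[F]).Coprime (Nat.card H)) :
    Continuous f := by
  classical
  -- the kernel has finite index dividing `|H|`
  haveI : f.ker.FiniteIndex := by
    refine ⟨fun h0 => ?_⟩
    have h := Subgroup.index_ker f
    rw [h0] at h
    exact (Nat.card_pos (α := f.range)).ne' h.symm
  have hdvd : f.ker.index ∣ Nat.card H := by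
    rw [Subgroup.index_ker f]
    exact Subgroup.card_subgroup_dvd_card f.range
  have hopen : IsOpen (f.ker : Set (absoluteGaloisGroup F)) :=
    isOpen_of_normal_of_index_coprime' F hG f.ker (Nat.Coprime.coprime_dvd_right hdvd hH)
  -- a homomorphism with open kernel into a discrete group is continuous
  refine continuous_def.mpr fun S _ => ?_
  rw [isOpen_iff_forall_mem_open]
  intro g hg
  refine ⟨g • (f.ker : Set (absoluteGaloisGroup F)), ?_, hopen.smul g, ⟨1, f.ker.one_mem, by simp⟩⟩
  rintro _ ⟨k, hk, rfl⟩
  show f (g • k) ∈ S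
  rw [smul_eq_mul, map_mul, (MonoidHom.mem_ker).mp hk, mul_one]
  exact hg

end MLFGaloisTameStronglyComplete

end Literature.AnabelianGeometry.AbsoluteAnabelian
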